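/-
Copyright: cell pub-balaban-gaps (YM BLITZ Y1, track G1), seat g1-p2 GEN 10 (unit `pub-balaban-gaps-g1-p2`).  Row (D4) NODE O,
OBJECT ∕ MECHANISM level: THEOREM 3.10 AT ONE SCALE FROM PER-CUBE GAUGED COERCIVITY — [B9] p. 409 «This theorem follows simply from
Corollary 3.6 holding for all G′_□» with Cor. 3.6's mechanism made explicit: GEN 5's parametrix junction
(`D4WalkBlockLocalInverse.blockWalkExpansion_accretive`) took ONE GLOBAL conjugated coercivity of `Δ′(u) = 1 + K′(u)`; here the
local-inverse letters are supplied CUBE BY CUBE, each cube `□` in ITS OWN site gauge `u_□` (print's (3.35): a gauge on `□` in which the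
field is small), from coercivity of the COMPRESSION to `□̃` of the GAUGED operator `u_□·Δ′·u_□⁻¹` only — via `D4WalkBlockLocalInverseGauge`
(`G′_□(U) = u_□⁻¹G′_□(U^{u_□})u_□`, letters `× rr′`).  The perturbation letter stays GLOBAL and O(1) (`‖K′‖ ≤ C_K`: its smallness is the
partition's `1∕M`, gauge-free).  HONEST FRAMING: mechanism; the per-cube gauges and the per-cube coercivity are hypothesis data (for
Bałaban's `Δ^{(k)}(𝐔)` they are (3.35)–(3.36) + Thms 3.1–3.3, NOT proved here); (D4) instance 0∕1; NOT BetaPertH, NOT continuum, NOT Clay.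
-/
import Summits.QuantumFields.BalabanUV.Gaps.D4WalkBlockLocalInverse
import Summits.QuantumFields.BalabanUV.Gaps.D4WalkBlockLocalInverseGauge

/-!
# `Gaps.D4WalkBlockLocalInverseGaugeEnd` — Thm 3.10 at one scale with the local inverses bounded cube by cube in per-cube gauges
# (cell pub-balaban-gaps, seat g1-p2 gen 10)

HONEST DEPENDENCY (cell pub-balaban, verbatim): continuum YM on T⁴ ⇐ BetaPertH ∧ nine spine estimates (0/9 proved);
BetaPertH ⇐ (D1) ∧ (D4) ∧ CAP+tail.

* §1 the three local-inverse letters of GEN 5 from coercivity of the COMPRESSION only (`isUnit_compress_of_coerciveS`,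
  `norm_locInvS_apply_le`, `blockNorm_locInvS_le`, `differentiableOn_locInvS`) — the compressed form sees the operator inside `□̃` alone.
* §2 `conj_conj_eq` and the per-cube GAUGED letters **`blockNorm_locInv_gauged_le`** (`‖G′_□(u)‖_{y,y′} ≤ rr′·c_s∕m`),
  **`differentiableOn_locInv_gauged`** — from a gauge `(g_□, g_□⁻)` with row sums `≤ r′, r` and the conjugated coercivity `m` of
  `compress (fibD g_□·Δ′(u)·fibD g_□⁻) □̃` on the ball.
* §3 END **`blockWalkExpansion_gaugedAccretive`** = GEN 5's `blockWalkExpansion_accretive` with `hcoer` (global) replaced by a gauge per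
  cube and the coercivity of the gauged compression per cube; `C_L = rr′·c_s∕m`; the same σ-decorated glued family, the same kernel.
WHAT IT IS NOT.  The instance for Bałaban's `Δ^{(k)}(𝐔)` with lit-balaban's `Reg335` cube family (per-cube small field ⟹ per-cube
coercivity: the one-cube chain of 59b–66 ∕ Cor. 3.5); (D4) instance 0∕1; words of row (D4) UNCHANGED.

References: T. Bałaban, Comm. Math. Phys. **99** (1985) 389–434 [B9], (3.35) p. 396, Cor. 3.6 p. 408, Thm 3.7 ∕ (3.87)–(3.90) p. 409,
Thm 3.10 p. 416; Comm. Math. Phys. **116** (1988) [II], (1.11) p. 5, p. 15.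
-/

noncomputable section

namespace Summit.QuantumFields.BalabanUV.Gaps.D4WalkBlockLocalInverseGaugeEnd

open Metric Set Finset Complex Matrix
open scoped BigOperators Matrix ComplexConjugate
open Literature.MathematicalPhysics.QuantumFieldTheory.Balaban1983to89
open Literature.MathematicalPhysics.QuantumFieldTheory.Balaban1983to89.B9SectDWalk (DomBy)
open Literature.MathematicalPhysics.QuantumFieldTheory.Balaban1983to89.B9Thm34Ext (toB6)
open Literature.MathematicalPhysics.QuantumFieldTheory.Balaban1983to89.B9Thm37GlueTorus (torusGeom tdist1)
open Literature.MathematicalPhysics.QuantumFieldTheory.Balaban1983to89.TreeLengthTorus (TPt)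
open Literature.MathematicalPhysics.QuantumFieldTheory.Balaban1983to89.B5TorusCover (UT)
open Literature.MathematicalPhysics.QuantumFieldTheory.Balaban1983to89.B11SectG (RowSum)
open Literature.MathematicalPhysics.QuantumFieldTheory.Balaban1983to89.B5Prop11Lower (nsq nsq_nonneg)
open Literature.MathematicalPhysics.QuantumFieldTheory.Balaban1983to89.B13DomainKernelWalks (DomainTerms)
open Literature.MathematicalPhysics.QuantumFieldTheory.Balaban1983to89.B13CovarianceDifference216 (differentiableOn_matrix_inv)
open Summit.QuantumFields.BalabanUV.Gaps.D4WalkBlock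
  (rowMass blockNorm blockNorm_nonneg rowMass_le_blockNorm blockNorm_le_of_rowMass_le BlockWalkExpansion)
open Summit.QuantumFields.BalabanUV.Gaps.D4WalkBlockCommutator (blockWalkExpansion_parametrix_lipschitz)
open Summit.QuantumFields.BalabanUV.T4Continuum.Spine.NE5.TwoRunPencilDomains (withOp)
open Summit.QuantumFields.BalabanUV.Beta.UnitLatticeWalkInversion (Hd Pj)
open Summit.QuantumFields.BalabanUV.Beta.UnitLatticeLocalInverse
  (compress extend extend_apply_of_mem extend_apply_of_not_mem_left extend_apply_of_not_mem_right)
open Summit.QuantumFields.BalabanUV.Beta.AccretiveCombesThomas (conjForm isUnit_of_conjCoercive norm_inv_apply_le)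
open Summit.QuantumFields.BalabanUV.Gaps.D4WalkBlockShiftAlgebra (fibD fibD_local differentiableOn_fibD_entry)
open Summit.QuantumFields.BalabanUV.Gaps.D4WalkBlockGaugeAlgebra (fibD_mul_fibD_eq_one)
open Summit.QuantumFields.BalabanUV.Gaps.D4WalkBlockLocalInverseGauge (locInv_conj blockNorm_locInv_conj_le)

/-! ## §1. The local-inverse letters from coercivity of the COMPRESSION alone -/

section LocInvS

variable {n : Type} [Fintype n] [DecidableEq n]

omit [Fintype n] in
/-- the compression is a unit when IT is conjugated-coercive (only the operator inside `□̃` is seen). -/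
theorem isUnit_compress_of_coerciveS (A : Matrix n n ℂ) (S : Finset n) (d : n → n → ℝ) {κ m : ℝ} (hm : 0 < m)
    (hc : ∀ j : S, ∀ z : S → ℂ, m * nsq z ≤ (conjForm (compress A S) κ (fun e : S => d e j) z).re) : IsUnit (compress A S) := by
  rcases isEmpty_or_nonempty S with hS | ⟨⟨j, hj⟩⟩
  · exact ⟨⟨compress A S, compress A S, Subsingleton.elim _ _, Subsingleton.elim _ _⟩, rfl⟩
  · exact isUnit_of_conjCoercive (ρ := fun k : S => d k j) hm (hc ⟨j, hj⟩)

omit [Fintype n] in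
/-- entrywise Combes–Thomas bound of the extended local inverse from coercivity of the compression. [cite: Balaban1985BackgroundPropagators, (3.42) p.399, Cor 3.6 p.408] -/
theorem norm_locInvS_apply_le (A : Matrix n n ℂ) (S : Finset n) (d : n → n → ℝ) (hd0 : ∀ j, d j j = 0) {κ m : ℝ}
    (hκ : 0 ≤ κ) (hm : 0 < m) (hc : ∀ j : S, ∀ z : S → ℂ, m * nsq z ≤ (conjForm (compress A S) κ (fun e : S => d e j) z).re)
    (i j : n) : ‖extend (compress A S)⁻¹ i j‖ ≤ m⁻¹ * Real.exp (-(κ * d i j)) := by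
  by_cases hi : i ∈ S
  · by_cases hj : j ∈ S
    · rw [extend_apply_of_mem _ hi hj]
      have h := norm_inv_apply_le (compress A S) (fun k l : S => d k l) (fun l => hd0 l) hκ hm hc ⟨i, hi⟩ ⟨j, hj⟩
      calc ‖(compress A S)⁻¹ ⟨i, hi⟩ ⟨j, hj⟩‖ ≤ Real.exp (-(κ * d i j)) / m := h
        _ = m⁻¹ * Real.exp (-(κ * d i j)) := by rw [div_eq_inv_mul]
    · rw [extend_apply_of_not_mem_right _ i hj, norm_zero]; positivity
  · rw [extend_apply_of_not_mem_left _ hi j, norm_zero]; positivity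

/-- block letter `c_s∕m` of the local inverse from coercivity of the compression. [cite: Balaban1985BackgroundPropagators, (3.42) p.399, (3.89) p.409] -/
theorem blockNorm_locInvS_le {ν : ℕ} {K : Fin ν → ℕ} (cubn : n → UT K) (A : Matrix n n ℂ) (S : Finset n)
    (d : n → n → ℝ) (hd0 : ∀ j, d j j = 0) {κ m cs : ℝ} (hκ : 0 ≤ κ) (hm : 0 < m)
    (hc : ∀ j : S, ∀ z : S → ℂ, m * nsq z ≤ (conjForm (compress A S) κ (fun e : S => d e j) z).re)
    (hcs : 0 ≤ cs) (hsite : ∀ i, ∑ j, Real.exp (-(κ * d i j)) ≤ cs) (y y' : UT K) :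
    blockNorm cubn cubn (extend (compress A S)⁻¹) y y' ≤ cs / m := by
  refine blockNorm_le_of_rowMass_le cubn cubn _ y y' (div_nonneg hcs hm.le) fun i _ => ?_
  calc rowMass cubn (extend (compress A S)⁻¹) i y'
      ≤ ∑ j ∈ Finset.univ.filter (fun j => cubn j = y'), m⁻¹ * Real.exp (-(κ * d i j)) :=
        Finset.sum_le_sum fun j _ => norm_locInvS_apply_le A S d hd0 hκ hm hc i j
    _ ≤ ∑ j, m⁻¹ * Real.exp (-(κ * d i j)) :=
        Finset.sum_le_sum_of_subset_of_nonneg (Finset.filter_subset _ _) fun j _ _ => by positivity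
    _ = m⁻¹ * ∑ j, Real.exp (-(κ * d i j)) := by rw [Finset.mul_sum]
    _ ≤ m⁻¹ * cs := mul_le_mul_of_nonneg_left (hsite i) (inv_nonneg.2 hm.le)
    _ = cs / m := by rw [div_eq_inv_mul]

variable {E : Type*} [NormedAddCommGroup E] [NormedSpace ℂ E]

omit [Fintype n] in
/-- holomorphy of the local inverse from coercivity of the compression on the ball. [cite: Balaban1988RG2Cluster, p.15] -/
theorem differentiableOn_locInvS {A : E → Matrix n n ℂ} {R : ℝ} (S : Finset n) (d : n → n → ℝ) {κ m : ℝ} (hm : 0 < m)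
    (ha : ∀ i j, DifferentiableOn ℂ (fun u => A u i j) (ball (0 : E) R))
    (hc : ∀ u ∈ ball (0 : E) R, ∀ j : S, ∀ z : S → ℂ, m * nsq z ≤ (conjForm (compress (A u) S) κ (fun e : S => d e j) z).re)
    (i j : n) : DifferentiableOn ℂ (fun u => extend (compress (A u) S)⁻¹ i j) (ball (0 : E) R) := by
  by_cases hi : i ∈ S
  · by_cases hj : j ∈ S
    · simp_rw [extend_apply_of_mem _ hi hj]
      refine differentiableOn_matrix_inv (A := fun u => compress (A u) S) (fun k l => ha k l) (fun u hu => ?_) ⟨i, hi⟩ ⟨j, hj⟩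
      exact ((Matrix.isUnit_iff_isUnit_det _).mp (isUnit_compress_of_coerciveS (A u) S d hm (hc u hu))).ne_zero
    · simp_rw [extend_apply_of_not_mem_right _ i hj]; exact differentiableOn_const _
  · simp_rw [extend_apply_of_not_mem_left _ hi j]; exact differentiableOn_const _

end LocInvS

/-! ## §2. The per-cube GAUGED letters -/

section Gauged

variable {X : Type} {F : Type} [Fintype X] [Fintype F] [DecidableEq X] [DecidableEq F]
variable {E : Type*} [NormedAddCommGroup E] [NormedSpace ℂ E]

/-- `g⁻·(g·M·g⁻)·g = M` for a sitewise two-sided inverse pair. -/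
theorem conj_conj_eq {g gi : X → Matrix F F ℂ} (hgi : ∀ x, gi x * g x = 1) (M : Matrix (X × F) (X × F) ℂ) : fibD X F gi * (fibD X F g * M * fibD X F gi) * fibD X F g = M := by
  simp only [← Matrix.mul_assoc]
  rw [fibD_mul_fibD_eq_one hgi, Matrix.one_mul, Matrix.mul_assoc, fibD_mul_fibD_eq_one hgi, Matrix.mul_one]

variable {ν : ℕ} {Kv : Fin ν → ℕ}

/-- **BLOCK LETTER OF THE LOCAL INVERSE IN ITS CUBE'S GAUGE**: fibre-saturated `S`, gauge `(g, g⁻)` with row sums `≤ r′, r`, the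
GAUGED compression `compress (fibD g·A·fibD g⁻) S` conjugated-coercive `m` at rate `κ ≥ 0`, site row sum `c_s` ⟹
`‖extend((compress A S)⁻¹)‖_{y,y′} ≤ rr′·c_s∕m`. [cite: Balaban1985BackgroundPropagators, (3.35) p.396, Cor. 3.6 p.408, (3.89) p.409] -/
theorem blockNorm_locInv_gauged_le (cub : X → UT Kv) {S : Finset (X × F)} (hS : ∀ p ∈ S, ∀ b : F, (p.1, b) ∈ S)
    {g gi : X → Matrix F F ℂ} (hg : ∀ x, g x * gi x = 1) (hgi : ∀ x, gi x * g x = 1) {r r' : ℝ} (hr0 : 0 ≤ r) (hr0' : 0 ≤ r')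
    (hr : ∀ x a, ∑ b, ‖gi x a b‖ ≤ r) (hr' : ∀ x a, ∑ b, ‖g x a b‖ ≤ r') (A : Matrix (X × F) (X × F) ℂ)
    (d : (X × F) → (X × F) → ℝ) (hd0 : ∀ j, d j j = 0) {κ m cs : ℝ} (hκ : 0 ≤ κ) (hm : 0 < m)
    (hc : ∀ j : S, ∀ z : S → ℂ,
      m * nsq z ≤ (conjForm (compress (fibD X F g * A * fibD X F gi) S) κ (fun e : S => d e j) z).re)
    (hcs : 0 ≤ cs) (hsite : ∀ i, ∑ j, Real.exp (-(κ * d i j)) ≤ cs) (y y' : UT Kv) :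
    blockNorm (fun p : X × F => cub p.1) (fun p : X × F => cub p.1) (extend (compress A S)⁻¹) y y' ≤ r * r' * (cs / m) := by
  have e : A = fibD X F gi * (fibD X F g * A * fibD X F gi) * fibD X F g := (conj_conj_eq hgi A).symm
  calc blockNorm (fun p : X × F => cub p.1) (fun p : X × F => cub p.1) (extend (compress A S)⁻¹) y y'
      = blockNorm (fun p : X × F => cub p.1) (fun p : X × F => cub p.1)
          (extend (compress (fibD X F gi * (fibD X F g * A * fibD X F gi) * fibD X F g) S)⁻¹) y y' := by rw [← e]
    _ ≤ r * r' * blockNorm (fun p : X × F => cub p.1) (fun p : X × F => cub p.1)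
          (extend (compress (fibD X F g * A * fibD X F gi) S)⁻¹) y y' :=
        blockNorm_locInv_conj_le hS cub hg hgi hr0 hr0' hr hr' _ y y'
    _ ≤ r * r' * (cs / m) :=
        mul_le_mul_of_nonneg_left (blockNorm_locInvS_le _ _ S d hd0 hκ hm hc hcs hsite y y') (mul_nonneg hr0 hr0')

/-- **HOLOMORPHY OF THE LOCAL INVERSE FROM ITS CUBE'S GAUGE**: `A(u)` entrywise holomorphic, the gauged compression coercive on the ball
⟹ entries of `u ↦ extend((compress A(u) S)⁻¹)` holomorphic. [cite: Balaban1988RG2Cluster, p.15] -/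
theorem differentiableOn_locInv_gauged {S : Finset (X × F)} (hS : ∀ p ∈ S, ∀ b : F, (p.1, b) ∈ S)
    {g gi : X → Matrix F F ℂ} (hg : ∀ x, g x * gi x = 1) (hgi : ∀ x, gi x * g x = 1) {A : E → Matrix (X × F) (X × F) ℂ} {R : ℝ}
    (d : (X × F) → (X × F) → ℝ) {κ m : ℝ} (hm : 0 < m) (ha : ∀ i j, DifferentiableOn ℂ (fun u => A u i j) (ball (0 : E) R))
    (hc : ∀ u ∈ ball (0 : E) R, ∀ j : S, ∀ z : S → ℂ,
      m * nsq z ≤ (conjForm (compress (fibD X F g * A u * fibD X F gi) S) κ (fun e : S => d e j) z).re)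
    (i j : X × F) : DifferentiableOn ℂ (fun u => extend (compress (A u) S)⁻¹ i j) (ball (0 : E) R) := by
  have e : ∀ u, extend (compress (A u) S)⁻¹ =
      fibD X F gi * extend (compress (fibD X F g * A u * fibD X F gi) S)⁻¹ * fibD X F g := fun u => by
    have h := locInv_conj hS hg hgi (fibD X F g * A u * fibD X F gi)
    rwa [conj_conj_eq hgi] at h
  have hcst : ∀ (M : Matrix (X × F) (X × F) ℂ) (a b : X × F), DifferentiableOn ℂ (fun _ : E => M a b) (ball (0 : E) R) :=
    fun M a b => differentiableOn_const _
  have hAg : ∀ k l, DifferentiableOn ℂ (fun u => (fibD X F g * A u * fibD X F gi) k l) (ball (0 : E) R) := fun k l =>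
    D4WalkProduct.differentiableOn_mul_entry (M₁ := fun u => fibD X F g * A u) (M₂ := fun _ => fibD X F gi)
      (D4WalkProduct.differentiableOn_mul_entry (M₁ := fun _ => fibD X F g) (M₂ := A) (hcst (fibD X F g)) ha)
      (hcst (fibD X F gi)) k l
  have hE := differentiableOn_locInvS (A := fun u => fibD X F g * A u * fibD X F gi) S d hm hAg hc
  have hE' : DifferentiableOn ℂ
      (fun u => (fibD X F gi * extend (compress (fibD X F g * A u * fibD X F gi) S)⁻¹ * fibD X F g) i j) (ball (0 : E) R) :=
    D4WalkProduct.differentiableOn_mul_entry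
      (M₁ := fun u => fibD X F gi * extend (compress (fibD X F g * A u * fibD X F gi) S)⁻¹) (M₂ := fun _ => fibD X F g)
      (D4WalkProduct.differentiableOn_mul_entry (M₁ := fun _ => fibD X F gi)
        (M₂ := fun u => extend (compress (fibD X F g * A u * fibD X F gi) S)⁻¹) (hcst (fibD X F gi)) hE)
      (hcst (fibD X F g)) i j
  exact hE'.congr fun u _ => congrFun (congrFun (e u) i) j

end Gauged

/-! ## §3. END: Theorem 3.10 at one scale from per-cube gauged coercivity -/

section End

variable {d N' : ℕ} {ν : ℕ} {K : Fin ν → ℕ} [∀ i, NeZero (K i)]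
variable {X : Type} {F : Type} [Fintype X] [Fintype F] [DecidableEq X] [DecidableEq F]
variable {E : Type*} [NormedAddCommGroup E] [NormedSpace ℂ E]
variable {L₀ : DomainTerms d N' ν K (X × F) (X × F) E} {h : L₀.B → (X × F) → ℝ} {Es : L₀.B → Finset (X × F)}
variable {K' : E → Matrix (X × F) (X × F) ℂ} {ds : (X × F) → (X × F) → ℝ}
variable {c : B13.Consts} {cub : X → UT K} {Xs : Finset (UT K)} {R CK M m κc cs r₁ r rg rg' : ℝ} {mJ nD nC : ℕ}
variable {ρ₀ ε₀ κ₀ μ cμ : ℝ} {g gi : L₀.B → X → Matrix F F ℂ}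

/-- **THEOREM 3.10 AT ONE SCALE FROM PER-CUBE GAUGED COERCIVITY** (Cor. 3.6's mechanism, p. 409): the hypotheses of
`D4WalkBlockLocalInverse.blockWalkExpansion_accretive` with the GLOBAL coercivity of `1 + K′(u)` replaced by — for every cube `□`: a
site gauge `(g_□, g_□⁻)` (two-sided inverses, row sums `≤ r_g′, r_g`), a fibre-saturated enlarged cube `□̃`, and conjugated coercivity
`m` at rate `κ_c` of the GAUGED COMPRESSION `compress (fibD g_□·(1 + K′(u))·fibD g_□⁻) □̃` uniformly on the ball — the operator seen
inside `□̃` in `□`'s own gauge (print: `U^{u_□} = e^{iηA}`, `A` small on `□`).  Conclusion: the same σ-decorated glued family with the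
local inverses `G′_□(u) = extend((compress (1 + K′(u)) □̃)⁻¹)` IS a block walk expansion, `C_L = r_gr_g′·c_s∕m`; the perturbation letter
`C_K` stays global (its smallness is the partition's `1∕M`). [cite: Balaban1985BackgroundPropagators, (3.35) p.396, Cor. 3.6 p.408, Thm 3.7 (3.87)–(3.90) p.409, Thm 3.10 p.416; Balaban1988RG2Cluster, (1.11) p.5, p.15] -/
theorem blockWalkExpansion_gaugedAccretive
    (hanchor : ∀ b, L₀.anchor b ∈ L₀.dom b) (hdiam : ∀ b, ∀ z ∈ L₀.dom b, ∀ z' ∈ L₀.dom b, tdist1 K z z' ≤ r)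
    (hJ : ∀ b, (L₀.J b).card ≤ mJ) (hX : ∀ b, (L₀.J b).Nonempty → (L₀.dom b ∩ Xs).Nonempty)
    (hmult : ∀ z : UT K, (Finset.univ.filter fun b => L₀.anchor b = z).card ≤ nD)
    (hsupp : ∀ b y, y ∉ Es b → h b y = 0) (habs : ∀ b y, |h b y| ≤ 1)
    (hE : ∀ b y, y ∈ Es b → (fun p : X × F => cub p.1) y ∈ L₀.dom b)
    (hKan : ∀ i j, DifferentiableOn ℂ (fun u => K' u i j) (ball (0 : E) R))
    (hKbd : ∀ u ∈ ball (0 : E) R, ∀ y y', blockNorm (fun p : X × F => cub p.1) (fun p : X × F => cub p.1) (K' u) y y' ≤ CK)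
    (hCK : 0 ≤ CK) (hM : 0 < M) (hr₁ : 0 ≤ r₁) (hsymm : ∀ i j, ds i j = ds j i) (hd0 : ∀ j, ds j j = 0)
    (hLip : ∀ b i j, |h b i - h b j| ≤ ds i j / M) (hKrange : ∀ u i j, K' u i j ≠ 0 → ds i j ≤ r₁)
    (hdomE : ∀ b i, (∃ k ∈ Es b, ds i k ≤ r₁) → (fun p : X × F => cub p.1) i ∈ L₀.dom b)
    (hcard : ∀ b, (L₀.dom b).card ≤ nC)
    (hm : 0 < m) (hκc : 0 ≤ κc)
    -- the per-cube gauges and the per-cube gauged coercivity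
    (hEs : ∀ b, ∀ p ∈ Es b, ∀ a : F, (p.1, a) ∈ Es b)
    (hg : ∀ b x, g b x * gi b x = 1) (hgi : ∀ b x, gi b x * g b x = 1) (hrg0 : 0 ≤ rg) (hrg0' : 0 ≤ rg')
    (hrg : ∀ b x a, ∑ b', ‖gi b x a b'‖ ≤ rg) (hrg' : ∀ b x a, ∑ b', ‖g b x a b'‖ ≤ rg')
    (hcoer : ∀ b, ∀ u ∈ ball (0 : E) R, ∀ j : Es b, ∀ z : Es b → ℂ,
      m * nsq z ≤ (conjForm (compress (fibD X F (g b) * (1 + K' u) * fibD X F (gi b)) (Es b)) κc (fun e : Es b => ds e j) z).re)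
    (hcs : 0 ≤ cs) (hsite : ∀ i, ∑ j, Real.exp (-(κc * ds i j)) ≤ cs)
    (hκ₁ : 0 ≤ c.κ₁) (hμ : 0 ≤ μ) (hμε : 3 * μ ≤ ε₀) (hμκ : 2 * μ ≤ κ₀) (hwin : κ₀ + μ ≤ ρ₀ - ε₀) (hcμ : 0 ≤ cμ)
    (hrow : RowSum (toB6 (torusGeom K 0 0 0) 0 True) μ cμ)
    (hq : cμ * (cμ * 1 *
      (1 * (((nC * (r₁ / M * CK) * (rg * rg' * (cs / m))) * Real.exp (c.κ₁ * mJ) * Real.exp (2 * ρ₀ * r)) * Real.exp (μ * r) *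
        (nD * cμ))) * cμ) * cμ < 1) :
    ∃ (W : Type) (T : W → (TPt d N' → ℂ) → E → Matrix (X × F) (X × F) ℂ) (SX : Set W) (A : W → ℝ) (D : W → UT K → UT K → ℝ)
      (ρ' : ℝ), BlockWalkExpansion c (fun p : X × F => cub p.1) (fun p : X × F => cub p.1)
        (fun σ₀ u =>
          (withOp L₀ fun b u => Hd h b * extend (compress (1 + K' u) (Es b))⁻¹ * Hd h b).kernel σ₀ u *
          ((1 : Matrix (X × F) (X × F) ℂ) + (-1 : ℂ) •
            (withOp L₀ fun b u =>
              (Hd h b * K' u - K' u * Hd h b) * extend (compress (1 + K' u) (Es b))⁻¹ * Hd h b).kernel σ₀ u)⁻¹)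
        Xs R (ε₀ - 3 * μ) (κ₀ - 2 * μ)
        (cμ * (((rg * rg' * (cs / m)) * Real.exp (c.κ₁ * mJ) * Real.exp (2 * ρ₀ * r)) * Real.exp (μ * r) * (nD * cμ)) *
          (1 * (1 - cμ * (cμ * 1 *
            (1 * (((nC * (r₁ / M * CK) * (rg * rg' * (cs / m))) * Real.exp (c.κ₁ * mJ) * Real.exp (2 * ρ₀ * r)) *
              Real.exp (μ * r) * (nD * cμ))) * cμ) * cμ)⁻¹) * cμ)
        T SX A D ρ' ∧
      ∀ ω, DomBy (toB6 (torusGeom K 0 0 0) 0 True) (D ω) := by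
  have ha : ∀ i j, DifferentiableOn ℂ (fun u => (1 + K' u) i j) (ball (0 : E) R) := fun k l => by
    simp only [Matrix.add_apply]
    exact (differentiableOn_const _).add (hKan k l)
  exact blockWalkExpansion_parametrix_lipschitz (L := withOp L₀ fun b u => extend (compress (1 + K' u) (Es b))⁻¹)
    hanchor hdiam hJ hX hmult hsupp habs hE
    (fun b i j => differentiableOn_locInv_gauged (hEs b) (hg b) (hgi b) ds hm ha (hcoer b) i j)
    (fun b u hu y y' => blockNorm_locInv_gauged_le cub (hEs b) (hg b) (hgi b) hrg0 hrg0' (hrg b) (hrg' b) (1 + K' u) ds hd0 hκc hm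
      (hcoer b u hu) hcs hsite y y')
    (mul_nonneg (mul_nonneg hrg0 hrg0') (div_nonneg hcs hm.le)) hKan hKbd hCK hM hr₁ hsymm (fun i => by rw [hd0]; exact hr₁) hLip
    hKrange hdomE hcard hκ₁ hμ hμε hμκ hwin hcμ hrow hq

end End

end Summit.QuantumFields.BalabanUV.Gaps.D4WalkBlockLocalInverseGaugeEnd

end
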